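import Mathlib

/-!
# The isolable-element / stabilizer count for identity tests in a bi-invariant test space
(negative lemma for the crux `SubgroupIdentityDesigns`, stmt-MatrixMultiplication-14079; applies verbatim
to the subset cruxes `LieRankDesigns`, `GradedDesignFamily` of route `LevelGradedCohnUmans`)

The MASTER FORM of the graded normalizer / permutability count (`GradedNormalizerCount.lean`), with no
subgroup structure at all.  Let `G` be a finite group, `J ≤ ℂ^G` BI-INVARIANT, `S ⊆ G` any set and
`f ∈ J` an IDENTITY TEST on `S`: `f 1 = 1`, `f s = 0` for `s ∈ S ∖ {1}`.  Call `x ∈ S` ISOLABLE if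
`x = u⁻¹ v⁻¹` for some `u, v` with `u S v ⊆ S`.  Then the probe `g ↦ f (u g v) ∈ J` is `1` at `x` and `0` at
every other isolable element (it maps `S` into `S` and only `x` to `1`), so:

* `card_le_finrank_of_isolable` — **the number of isolable elements is at most `dim J`.**
* `card_mul_card_le_finrank_of_stabilizers` — if subgroups `L, R ≤ G` stabilise `S` from the left and
  from the right (`L S ⊆ S`, `S R ⊆ S`), `1 ∈ S` and `L ∩ R = 1`, then every `l r` is isolable
  (`u = l⁻¹, v = r⁻¹`), so **`|L| · |R| ≤ dim J`.**

For a subgroup triple `S = H₁H₂H₃` with the subgroup TPP this recovers (and explains) the walls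
(`L = H₁, R = H₃`), the graded normalizer/permutability counts (`R = K H₃` for `K ≤ H₂` conjugating
`H₃` into `H₂H₃`), and the template death (`R = H₂H₃` when that is a subgroup: `V = |H₁||H₂H₃| ≤ dim J`);
in general `dim J ≥ |Stab_L(S) · Stab_R(S)|`, so a design of volume `V ≫ dim J` needs a product set
`H₁H₂H₃` whose one-sided stabilisers are essentially `H₁` and `H₃`.  For SUBSET designs (`X, Y, Z`
`J`-separated, target `(x₀, z₀)`, `S = x₀X⁻¹YY⁻¹Zz₀⁻¹`, `f = ` the translated separator) it charges any
right-coset structure of `X` and `Z`: `X A = X`, `Z B = Z` ⇒ `|x₀Ax₀⁻¹ · z₀Bz₀⁻¹| ≤ dim J`.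
Sorry-free; axioms `propext`, `Classical.choice`, `Quot.sound`.
-/

set_option linter.dupNamespace false

noncomputable section

open scoped BigOperators Classical
open Module

namespace Summit.MatrixMultiplication.MatrixMultiplication.Theorems.SubgroupIdentityDesigns.Negative

variable {G : Type} [Group G] [Finite G]

/-- **ISOLABLE-ELEMENT COUNT.**  `J ≤ ℂ^G` bi-invariant, `f ∈ J` an identity test on a set `S`
(`f 1 = 1`, `f = 0` on `S ∖ {1}`), `I ⊆ S` a finite set of ISOLABLE elements (each `x ∈ I` is
`u⁻¹v⁻¹` for some `u, v` with `u S v ⊆ S`).  Then `|I| ≤ dim J`: the probes `g ↦ f (u g v)` are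
biorthogonal to the evaluations at the points of `I`. -/
theorem card_le_finrank_of_isolable (J : Submodule ℂ (G → ℂ))
    (hJ : ∀ f ∈ J, ∀ a b : G, (fun g : G => f (a * g * b)) ∈ J)
    (S : Set G) {f : G → ℂ} (hf : f ∈ J) (h1 : f 1 = 1) (h0 : ∀ s ∈ S, s ≠ 1 → f s = 0)
    (I : Finset G) (hIS : ∀ x ∈ I, x ∈ S)
    (hI : ∀ x ∈ I, ∃ u v : G, u⁻¹ * v⁻¹ = x ∧ ∀ s ∈ S, u * s * v ∈ S) :
    I.card ≤ Module.finrank ℂ J := by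
  classical
  haveI : Fintype G := Fintype.ofFinite G
  choose! u v huv hS using hI
  -- probes indexed by the subtype of `I`
  let w : ↥I → J := fun x => ⟨fun g => f (u x * g * v x), hJ f hf _ _⟩
  have hw : ∀ x y : ↥I, (w x : G → ℂ) (y : G) = if x = y then 1 else 0 := by
    rintro ⟨x, hx⟩ ⟨y, hy⟩
    show f (u x * y * v x) = _
    by_cases hxy : x = y
    · subst hxy
      have e : u x * x * v x = 1 := by
        calc u x * x * v x = u x * ((u x)⁻¹ * (v x)⁻¹) * v x := by rw [huv x hx]
          _ = 1 := by group
      rw [e, h1, if_pos rfl]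
    · rw [if_neg (fun h => hxy (congrArg Subtype.val h))]
      refine h0 _ (hS x hx y (hIS y hy)) fun h => hxy ?_
      -- `u x * y * v x = 1` forces `y = (u x)⁻¹ (v x)⁻¹ = x`
      have hy' : y = (u x)⁻¹ * (v x)⁻¹ := by
        calc y = (u x)⁻¹ * (u x * y * v x) * (v x)⁻¹ := by group
          _ = (u x)⁻¹ * 1 * (v x)⁻¹ := by rw [h]
          _ = (u x)⁻¹ * (v x)⁻¹ := by group
      exact (hy'.trans (huv x hx)).symm
  have hli : LinearIndependent ℂ w := by
    rw [Fintype.linearIndependent_iff]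
    intro g hg y
    have := congrArg (fun φ : J => (φ : G → ℂ) (y : G)) hg
    simpa [Submodule.coe_sum, Finset.sum_apply, hw, Finset.sum_ite_eq', Finset.mem_univ] using this
  have h := hli.fintype_card_le_finrank
  rwa [Fintype.card_coe] at h

/-- **STABILIZER COUNT.**  If subgroups `L, R ≤ G` stabilise the tested set `S ∋ 1` from the left and
from the right (`L S ⊆ S`, `S R ⊆ S`) and `L ∩ R = 1`, then `|L| · |R| ≤ dim J`: every product `l r` is
isolable (`u = l⁻¹`, `v = r⁻¹`).  With `S = H₁H₂H₃`: `L = H₁`, `R = H₃` is the wall; `R = H₂H₃` (when a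
subgroup) is the death of the Borel template; in general `R ⊇ H₃ · {b ∈ H₂ : b H₃ b⁻¹ ⊆ H₂H₃}`. -/
theorem card_mul_card_le_finrank_of_stabilizers (J : Submodule ℂ (G → ℂ))
    (hJ : ∀ f ∈ J, ∀ a b : G, (fun g : G => f (a * g * b)) ∈ J)
    (S : Set G) (hS1 : (1 : G) ∈ S) {f : G → ℂ} (hf : f ∈ J) (h1 : f 1 = 1)
    (h0 : ∀ s ∈ S, s ≠ 1 → f s = 0)
    (L R : Subgroup G) (hL : ∀ l ∈ L, ∀ s ∈ S, l * s ∈ S) (hR : ∀ r ∈ R, ∀ s ∈ S, s * r ∈ S)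
    (hLR : L ⊓ R = ⊥) :
    Nat.card L * Nat.card R ≤ Module.finrank ℂ J := by
  classical
  haveI : Fintype G := Fintype.ofFinite G
  -- the product map is injective on `L × R`
  let m : ↥L × ↥R → G := fun t => (t.1 : G) * (t.2 : G)
  have hm : Function.Injective m := by
    rintro ⟨⟨l, hl⟩, ⟨r, hr⟩⟩ ⟨⟨l', hl'⟩, ⟨r', hr'⟩⟩ he
    simp only [m] at he
    have hmem : l'⁻¹ * l ∈ L ⊓ R := by
      refine Subgroup.mem_inf.2 ⟨L.mul_mem (L.inv_mem hl') hl, ?_⟩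
      have : l'⁻¹ * l = r' * r⁻¹ := by
        calc l'⁻¹ * l = l'⁻¹ * (l * r) * r⁻¹ := by group
          _ = l'⁻¹ * (l' * r') * r⁻¹ := by rw [he]
          _ = r' * r⁻¹ := by group
      rw [this]
      exact R.mul_mem hr' (R.inv_mem hr)
    rw [hLR, Subgroup.mem_bot, inv_mul_eq_one] at hmem
    subst hmem
    have hrr : r = r' := mul_left_cancel he
    subst hrr
    rfl
  -- its image consists of isolable elements of `S`
  set I : Finset G := Finset.univ.image m with hIdef
  have hcard : I.card = Nat.card L * Nat.card R := by
    rw [hIdef, Finset.card_image_of_injective _ hm, Finset.card_univ, Fintype.card_prod,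
      Nat.card_eq_fintype_card, Nat.card_eq_fintype_card]
  rw [← hcard]
  refine card_le_finrank_of_isolable J hJ S hf h1 h0 I (fun x hx => ?_) (fun x hx => ?_)
  · obtain ⟨⟨⟨l, hl⟩, ⟨r, hr⟩⟩, -, rfl⟩ := Finset.mem_image.1 hx
    exact hR r hr _ (by simpa using hL l hl 1 hS1)
  · obtain ⟨⟨⟨l, hl⟩, ⟨r, hr⟩⟩, -, rfl⟩ := Finset.mem_image.1 hx
    refine ⟨l⁻¹, r⁻¹, by simp [m], fun s hs => ?_⟩
    exact hR _ (R.inv_mem hr) _ (hL _ (L.inv_mem hl) s hs)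

end Summit.MatrixMultiplication.MatrixMultiplication.Theorems.SubgroupIdentityDesigns.Negative

end
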